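import Literature.AnabelianGeometry.EtaleTheta.GalSectSplittingsCohomology
import Literature.AnabelianGeometry.EtaleTheta.SettingModelChiCusp
import HarnessLib

/-!
# [GalSect] §4 torsor over `H¹` — the UN-VACUOUS instance at the χ-twisted model with a cusp (`curveχ′`)

S. Mochizuki, *Galois sections in absolute anabelian geometry* [GalSect], Nagoya Math. J. **179** (2005), §4
p.33: "the splittings … form a torsor over `H¹(G_K, Ẑ(1))`" [cite: MochizukiGalSect2005, §4 p.33].
Sequel of `GalSectSplittingsCohomology` (abc-iut-w5-d029; the generic theorem `TemperedCurve.cuspTorsorH1`) at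
the R78 model `curveχ′ p` (`SettingModelChiCusp`, p429840): the canonical section `G_{ℚ_p} ↪ b^Ẑ ⋊ G_{ℚ_p}` IS a
splitting of the synthetic cusp (`inrSplittingχ`), hence the splitting classes there form a torsor under
`Ker(res) ⊆ H¹(b^Ẑ ⋊ G_{ℚ_p}, b^Ẑ)` (`cuspTorsorH1χ`) — the first un-vacuous instance of the §4 torsor WITH
ITS COHOMOLOGICAL STRUCTURE GROUP in the tree (L3's cusp witness of abc-iut-w5-d040 is another, untwisted).
Semi-synthetic model; [GalSect] refereed; typed ≠ proved; no side taken on [IUTchIII] Cor. 3.12.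
-/

noncomputable section

/-! ### The instance at the χ-twisted model with a cusp (`curveχ′`, p429840) -/

namespace Literature.AnabelianGeometry.EtaleTheta.SettingModel

open Literature.AnabelianGeometry.SemiGraphs GalSect

variable (p : ℕ) [Fact p.Prime]

/-- `Π^tp_X = Γ ⋊_χ G_{ℚ_p}` is Hausdorff (product of Hausdorff spaces, induced topology).
[cite: MochizukiEtTh2009, §1 p.12] -/
theorem t2Space_PiTpχ : T2Space (PiTpχ p) := Semidirect.t2Space_of (isInducing_leftRightχ p)

/-- **The canonical section `G_{ℚ_p} ↪ b^Ẑ ⋊ G_{ℚ_p}` is a SPLITTING** of the synthetic cusp of `curveχ′`: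
`S₀ := inr(G_{ℚ_p})` is closed (`= left⁻¹{1}`), lies in `D`, meets `I = inl(b^Ẑ)` trivially and generates
`D` with it. [cite: MochizukiGalSect2005, §4 p.33] -/
theorem inrSplittingχ :
    (SemidirectProduct.inr : GQp p →* PiTpχ p).range ∈ (cuspPairOf (curveχ' p) ()).splittings := by
  haveI := t2Space_PiTpχ p
  have hrange : ((SemidirectProduct.inr : GQp p →* PiTpχ p).range : Set (PiTpχ p)) =
      (fun g : PiTpχ p => g.left) ⁻¹' {1} := by
    ext g
    constructor
    · rintro ⟨σ, rfl⟩; exact SemidirectProduct.left_inr σ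
    · intro hg
      exact ⟨g.right, SemidirectProduct.ext (by simpa using hg.symm) (by simp)⟩
  refine ⟨?_, ?_, ?_, ?_⟩
  · rw [hrange]
    exact isClosed_singleton.preimage (Semidirect.continuous_left (isInducing_leftRightχ p))
  · rintro _ ⟨σ, rfl⟩
    exact inr_mem_cuspDecomp (actχ p) (actχ_stabilises p) σ
  · rw [eq_bot_iff]
    rintro g ⟨⟨σ, rfl⟩, hI⟩
    have hI' : (SemidirectProduct.inr σ : PiTpχ p) ∈ (curveχ' p).inertia () := hI
    rw [inertia_curveχ'_eq] at hI'
    obtain ⟨q, -, hq⟩ := hI'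
    have : σ = 1 := by
      have h := congrArg SemidirectProduct.right hq
      simpa using h.symm
    rw [Subgroup.mem_bot, this, map_one]
  · apply le_antisymm
    · exact sup_le (by rintro _ ⟨σ, rfl⟩; exact inr_mem_cuspDecomp (actχ p) (actχ_stabilises p) σ)
        inf_le_left
    · intro g hg
      have hdec : (SemidirectProduct.inl g.left : PiTpχ p) * SemidirectProduct.inr g.right = g :=
        SemidirectProduct.inl_left_mul_inr_right g
      rw [← hdec]
      refine Subgroup.mul_mem _ (Subgroup.mem_sup_right ?_) (Subgroup.mem_sup_left ⟨g.right, rfl⟩)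
      change (SemidirectProduct.inl g.left : PiTpχ p) ∈ (curveχ' p).inertia ()
      rw [inertia_curveχ'_eq]
      exact ⟨g.left, hg, rfl⟩


/-! ### The continuous SECTION of `D_x ↠ G_K` at the synthetic cusp (cf. GAP G-L2d3-6: «a continuous section of
D̄_x ↠ G_K … exists in print because the cusp is K-rational») -/

/-- **The continuous section `G_{ℚ_p} → D_x = b^Ẑ ⋊ G_{ℚ_p}`** of the augmentation at the cusp of `curveχ′`
(`σ ↦ (1, σ)`), as a continuous homomorphism into `Π^tp_X`. [cite: MochizukiEtTh2009, Prop 2.2 (ii) p.37] -/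
def cuspSectionχ : GQp p →ₜ* PiTpχ p where
  toMonoidHom := SemidirectProduct.inr
  continuous_toFun := continuous_inrχ p

/-- `aug ∘ sect = id`. [cite: MochizukiEtTh2009, Prop 2.2 (ii) p.37] -/
@[simp] theorem augχ_cuspSectionχ (σ : GQp p) : augχ p (cuspSectionχ p σ) = σ := rfl

/-- The section lands in the decomposition group of the cusp. [cite: MochizukiEtTh2009, Prop 2.2 (ii) p.37] -/
theorem cuspSectionχ_mem_decomp (σ : GQp p) : cuspSectionχ p σ ∈ (curveχ' p).decomp () :=
  inr_mem_cuspDecomp (actχ p) (actχ_stabilises p) σ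

/-- Its range is the base splitting `S₀` of `inrSplittingχ`. [cite: MochizukiGalSect2005, §4 p.33] -/
theorem range_cuspSectionχ :
    (cuspSectionχ p).toMonoidHom.range = (SemidirectProduct.inr : GQp p →* PiTpχ p).range := rfl

/-- So `OncePuncturedData`'s proposed v-next field «`sect x : G_K →* D_x`, a continuous section» (GAP
G-L2d3-6) is witnessed at `curveχ′` with `G_K = G_{ℚ_p}`: a continuous section with range a CLOSED splitting.
[cite: MochizukiEtTh2009, Prop 2.2 (ii) p.37] -/
theorem exists_continuous_section_cuspχ :
    ∃ s : GQp p →ₜ* PiTpχ p, (∀ σ, augχ p (s σ) = σ) ∧ (∀ σ, s σ ∈ (curveχ' p).decomp ()) ∧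
      s.toMonoidHom.range ∈ (cuspPairOf (curveχ' p) ()).splittings :=
  ⟨cuspSectionχ p, augχ_cuspSectionχ p, cuspSectionχ_mem_decomp p, inrSplittingχ p⟩

/-- **The first un-vacuous instance of the [GalSect] §4 torsor in the tree**: at the synthetic cusp of
`curveχ′ p` the splitting classes form a torsor under `Ker(res) ⊆ H¹(b^Ẑ ⋊ G_{ℚ_p}, b^Ẑ)`.
[cite: MochizukiGalSect2005, §4 p.33] -/
def cuspTorsorH1χ :
    haveI := t2Space_PiTpχ p
    haveI : IsMulCommutative (cuspPairOf (curveχ' p) ()).I := (curveχ' p).isMulCommutative_inertia (x := ()) trivial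
    haveI := (cuspPairOf (curveχ' p) ()).ID_normal
    (cuspPairOf (curveχ' p) ()).TorsorData ↥(ContH1.resKer (cuspPairOf (curveχ' p) ()).ID
      (⊤ : Subgroup (cuspPairOf (curveχ' p) ()).D)
      ((cuspPairOf (curveχ' p) ()).isClosedComplement_of_mem_splittings (inrSplittingχ p)).le_left) :=
  haveI := t2Space_PiTpχ p
  (curveχ' p).cuspTorsorH1 (x := ()) trivial (inrSplittingχ p)

/-- Non-vacuity bookkeeping: the §4 torsor record `CuspPair.TorsorData` is inhabited at a cusp of a model with
its GENUINE cohomological structure group. [cite: MochizukiGalSect2005, §4 p.33] -/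
theorem nonempty_cuspTorsorH1χ :
    haveI := t2Space_PiTpχ p
    haveI : IsMulCommutative (cuspPairOf (curveχ' p) ()).I := (curveχ' p).isMulCommutative_inertia (x := ()) trivial
    haveI := (cuspPairOf (curveχ' p) ()).ID_normal
    Nonempty ((cuspPairOf (curveχ' p) ()).TorsorData ↥(ContH1.resKer (cuspPairOf (curveχ' p) ()).ID
      (⊤ : Subgroup (cuspPairOf (curveχ' p) ()).D)
      ((cuspPairOf (curveχ' p) ()).isClosedComplement_of_mem_splittings (inrSplittingχ p)).le_left)) :=
  ⟨cuspTorsorH1χ p⟩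

end Literature.AnabelianGeometry.EtaleTheta.SettingModel

end
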